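import Literature.NumberTheory.Automorphic.UnitaryThreeDoubleCosetsHK
import HarnessLib

/-!
# Flicker's double cosets `H∖G∕K` of the quasi-split `p`-adic `U(3)` — file 2: the stabiliser `H^K_m = H ∩ u_m K u_m⁻¹` by congruences
# (Flicker 1998, «Elementary proof of the fundamental lemma for a unitary group», Prop. 4 p. 81)

Topic `NumberTheory/Automorphic`; namespace `Literature.NumberTheory.Automorphic.UnitaryGroup`.  THEOREMS ONLY (no `def`, no instance, no notation, no named fact,
no `sorry`).  Cell `pub/hodgecm-mathlib`, ENGINE T1 (crux H413 = `stmt-HodgeConjecture-24833`); books row #103-ns, road «N7-ns COUNT FROM FLICKER» (MAP v3 a5916cc7,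
architect A-p06 (g26)), brick (F1) file 2 (file 1 = ★ `UnitaryThreeDoubleCosetsHK`, p840820; LEAD F0P3a-plan (g9) T8-41; author B-p17 (g24), 2026-09-01).  Frame as in
file 1: `LocalConjDatum σ ϖ`, `U = U(σ, Φ₃)(K)`, `K₀ = unitaryInt σ J`, `H = Z_U(diag(1,−1,1))`, `y σy = −2`, `u_m = !![ϖ^m, y, ϖ^{-m}; 0, 1, −σy ϖ^{-m}; 0, 0, ϖ^{-m}]`.
* `exists_coe_eq_block_of_mem_centralizer` — `h ∈ H ⇒ h = !![α,0,β; 0,e,0; γ,0,δ]`; `v_eq_one_of_coe_eq_block` — `|e| = 1`.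
* **`coe_flickerU_inv_mul_mul_flickerU`** — the explicit conjugate `u_m⁻¹ h u_m = !![α+γ, y(α+γ−e)∕t, (α+β+γ+δ−2e)∕t²; t·σy·γ, e−2γ, σy(γ+δ−e)∕t; t²γ, t·y·γ, γ+δ]`
  (`t = ϖ^m`; proved as `h·u_m = u_m·R` — six polynomial identities modulo `y σy = −2` — then cancelling `u_m`).
* **`flickerU_inv_mul_mul_flickerU_mem_unitaryInt_iff`** — `u_m⁻¹ h u_m ∈ K₀ ↔ |γ| ≤ 1 ∧ |α+γ−e| ≤ |t| ∧ |γ+δ−e| ≤ |t| ∧ |α+β+γ+δ−2e| ≤ |t|²`: the subgroup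
  `H^K_m` of Prop. 4 as CONGRUENCES (`h` integral, `α ≡ δ ≡ e − γ (mod t)`, `α+β+γ+δ ≡ 2e (mod t²)`); Flicker's parametrisation `α = a₁−b+ta₂`, `γ = b`, `e = a₁`,
  `δ = a₁−b−tb₃`, `β = b−ta₂+tb₃+2a₃t²` (`aᵢ, b, b₃ ∈ R_E`) is precisely its solution set — the form (F2)∕(F3c)∕(F4)–(F8) read.
* (ED. 2) `exists_mul_mul_eq_mul_mul_iff_mem_unitaryInt`, `inv_mul_mem_unitaryInt_iff` — `h u K₀ = h′ u K₀ ↔ u⁻¹(h⁻¹h′)u ∈ K₀` (Prop. 8's bookkeeping; B-p04 (F3c)).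
HONEST LABEL: HC_CM is proved only modulo the printed citations until rung 0 closes; structure theory for ONE clause of #103-ns, pays nothing by itself.

## References
* [Flicker1998UnitaryFL] Y. Z. Flicker, *Elementary proof of the fundamental lemma for a unitary group*, Canad. J. Math. 50 (1998), §2 p. 78, Prop. 4 p. 81 (`H^K_m`).
* [Rogawski1990] J. D. Rogawski, *Automorphic Representations of Unitary Groups in Three Variables* (1990), §1.9–§1.10 pp. 8–9. -/

set_option autoImplicit false

open scoped MatrixGroups WithZero
open Matrix

namespace Literature.NumberTheory.Automorphic

namespace UnitaryGroup

open Literature.NumberTheory.Automorphic.HermitianLattice (unitaryInt mem_unitaryInt_iff LocalConjDatum)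

section Stabilizer

variable {K : Type*} [Field K] [Valued K ℤᵐ⁰] {ϖ : K}
  (σ : K →+* K) {J : Matrix (Fin 3) (Fin 3) K} (hJ : J = (StdForm.antidiagonal 3).over K)

omit [Valued K ℤᵐ⁰] in
/-- An element of `H = Z_U(diag(1,−1,1))` has matrix `!![α,0,β; 0,e,0; γ,0,δ]` for some `α β γ δ e`. [cite: Flicker1998UnitaryFL, §2 p. 78] -/
theorem exists_coe_eq_block_of_mem_centralizer (h2 : (2 : K) ≠ 0) {c h : ↥(unitaryGroupOfForm σ J)}
    (hc : ((c : GL (Fin 3) K) : Matrix (Fin 3) (Fin 3) K) = !![1, 0, 0; 0, -1, 0; 0, 0, 1])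
    (hh : h ∈ Subgroup.centralizer ({c} : Set ↥(unitaryGroupOfForm σ J))) :
    ∃ α β γ δ e : K, ((h : GL (Fin 3) K) : Matrix (Fin 3) (Fin 3) K) = !![α, 0, β; 0, e, 0; γ, 0, δ] := by
  obtain ⟨h01, h10, h12, h21⟩ := apply_eq_zero_of_mem_centralizer σ h2 hc hh
  refine ⟨((h : GL (Fin 3) K) : Matrix (Fin 3) (Fin 3) K) 0 0, ((h : GL (Fin 3) K) : Matrix (Fin 3) (Fin 3) K) 0 2,
    ((h : GL (Fin 3) K) : Matrix (Fin 3) (Fin 3) K) 2 0, ((h : GL (Fin 3) K) : Matrix (Fin 3) (Fin 3) K) 2 2,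
    ((h : GL (Fin 3) K) : Matrix (Fin 3) (Fin 3) K) 1 1, ?_⟩
  ext i j
  fin_cases i <;> fin_cases j <;> first | rfl | exact h01 | exact h10 | exact h12 | exact h21

/-- **The conjugate `u_m⁻¹ h u_m` of a block element `h = !![α,0,β;0,e,0;γ,0,δ] ∈ H`, explicitly** (`t = ϖ^m`, `y σy = −2`):
`u_m⁻¹ h u_m = !![α+γ, y(α+γ−e)∕t, (α+β+γ+δ−2e)∕t²; t·σy·γ, e−2γ, σy(γ+δ−e)∕t; t²γ, t·y·γ, γ+δ]` (Flicker's computation p. 81, in the Φ₃ frame).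
[cite: Flicker1998UnitaryFL, Prop. 4 p. 81] -/
theorem coe_flickerU_inv_mul_mul_flickerU (hd : LocalConjDatum σ ϖ) {y : K} (hy : y * σ y = -2) (m : ℕ)
    {u h : ↥(unitaryGroupOfForm σ J)}
    (hu : ((u : GL (Fin 3) K) : Matrix (Fin 3) (Fin 3) K) = !![ϖ ^ m, y, (ϖ ^ m)⁻¹; 0, 1, -σ y * (ϖ ^ m)⁻¹; 0, 0, (ϖ ^ m)⁻¹])
    {α β γ δ e : K} (hh : ((h : GL (Fin 3) K) : Matrix (Fin 3) (Fin 3) K) = !![α, 0, β; 0, e, 0; γ, 0, δ]) :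
    (((u⁻¹ * h * u : ↥(unitaryGroupOfForm σ J)) : GL (Fin 3) K) : Matrix (Fin 3) (Fin 3) K) =
      !![α + γ, y * (α + γ - e) * (ϖ ^ m)⁻¹, (α + β + γ + δ - 2 * e) * (ϖ ^ m)⁻¹ * (ϖ ^ m)⁻¹;
         ϖ ^ m * σ y * γ, e - 2 * γ, σ y * (γ + δ - e) * (ϖ ^ m)⁻¹;
         ϖ ^ m * ϖ ^ m * γ, ϖ ^ m * y * γ, γ + δ] := by
  have hϖ0 : ϖ ≠ 0 := by
    intro h0; have := hd.vϖ; rw [h0, map_zero] at this; exact WithZero.zero_ne_coe this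
  have ht0 : ϖ ^ m ≠ 0 := pow_ne_zero _ hϖ0
  -- `h · u = u · R`, then cancel `u` on the left
  have key : ((h : GL (Fin 3) K) : Matrix (Fin 3) (Fin 3) K) * ((u : GL (Fin 3) K) : Matrix (Fin 3) (Fin 3) K) =
      ((u : GL (Fin 3) K) : Matrix (Fin 3) (Fin 3) K) *
        !![α + γ, y * (α + γ - e) * (ϖ ^ m)⁻¹, (α + β + γ + δ - 2 * e) * (ϖ ^ m)⁻¹ * (ϖ ^ m)⁻¹;
           ϖ ^ m * σ y * γ, e - 2 * γ, σ y * (γ + δ - e) * (ϖ ^ m)⁻¹;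
           ϖ ^ m * ϖ ^ m * γ, ϖ ^ m * y * γ, γ + δ] := by
    rw [hh, hu]
    simp only [Matrix.mul_fin_three]
    ext i j
    fin_cases i <;> fin_cases j <;> simp only [Matrix.of_apply, Matrix.cons_val', Matrix.cons_val_zero, Matrix.cons_val_one,
      Matrix.cons_val_fin_one, Matrix.cons_val, Matrix.empty_val', Fin.mk_one, Fin.zero_eta, Fin.reduceFinMk, mul_zero, zero_mul,
      add_zero, zero_add, mul_one, one_mul]
    all_goals field_simp
    · linear_combination (-γ) * hy
    · ring
    · linear_combination (-(γ + δ - e)) * hy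
    · ring
    · linear_combination γ * hy
    · ring
  rw [Subgroup.coe_mul, Subgroup.coe_mul, Units.val_mul, Units.val_mul, Matrix.mul_assoc, key, ← Matrix.mul_assoc, Subgroup.coe_inv,
    Units.inv_mul, Matrix.one_mul]

/-- `rev` on `Fin 3`. [folklore] -/ private theorem rev0₃ : Fin.rev (0 : Fin 3) = 2 := rfl
/-- `rev` on `Fin 3`. [folklore] -/ private theorem rev1₃ : Fin.rev (1 : Fin 3) = 1 := rfl
/-- `rev` on `Fin 3`. [folklore] -/ private theorem rev2₃ : Fin.rev (2 : Fin 3) = 0 := rfl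

include hJ in
/-- For a block element `h = !![α,0,β;0,e,0;γ,0,δ] ∈ U` the middle entry is a unit: `|e| = 1` (`σ(e)e = 1`). [cite: Flicker1998UnitaryFL, §2 p. 78] -/
theorem v_eq_one_of_coe_eq_block (hσv : ∀ x, Valued.v (σ x) = Valued.v x) {h : ↥(unitaryGroupOfForm σ J)} {α β γ δ e : K}
    (hh : ((h : GL (Fin 3) K) : Matrix (Fin 3) (Fin 3) K) = !![α, 0, β; 0, e, 0; γ, 0, δ]) : Valued.v e = 1 := by
  have hrel := sum_rel_of_mem σ hJ h 1 1
  rw [hh] at hrel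
  simp only [Fin.sum_univ_three, rev0₃, rev1₃, rev2₃, if_true] at hrel
  simp only [Matrix.of_apply, Matrix.cons_val', Matrix.cons_val_zero, Matrix.cons_val_one, Matrix.cons_val_fin_one, Matrix.cons_val,
    Matrix.empty_val', map_zero, mul_zero, add_zero, zero_add] at hrel
  have hv := congrArg Valued.v hrel
  rw [map_mul, hσv, map_one] at hv
  exact Literature.NumberTheory.QuadraticForms.OMeara65.WithZeroMulInt.eq_one_of_mul_self hv

include hJ in
/-- **`H^K_m = H ∩ u_m K₀ u_m⁻¹` BY CONGRUENCES** [Flicker1998UnitaryFL Prop. 4, p. 81]: for a block element `h = !![α,0,β;0,e,0;γ,0,δ] ∈ H` and `t = ϖ^m`,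
`u_m⁻¹ h u_m ∈ K₀ ↔ |γ| ≤ 1 ∧ |α+γ−e| ≤ |t| ∧ |γ+δ−e| ≤ |t| ∧ |α+β+γ+δ−2e| ≤ |t|²` — i.e. `h` is INTEGRAL with `α ≡ δ ≡ e − γ (mod t)` and
`α+β+γ+δ ≡ 2e (mod t²)`; Flicker's parametrisation `α = a₁−b+ta₂`, `γ = b`, `e = a₁`, `δ = a₁−b−tb₃`, `β = b−ta₂+tb₃+2a₃t²` (`aᵢ, b, b₃ ∈ R_E`) is exactly its
solution set.  This is the set whose volumes (F4)–(F8) compute. [cite: Flicker1998UnitaryFL, Prop. 4 p. 81] -/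
theorem flickerU_inv_mul_mul_flickerU_mem_unitaryInt_iff (hd : LocalConjDatum σ ϖ) {y : K} (hy : y * σ y = -2) (m : ℕ)
    {u h : ↥(unitaryGroupOfForm σ J)}
    (hu : ((u : GL (Fin 3) K) : Matrix (Fin 3) (Fin 3) K) = !![ϖ ^ m, y, (ϖ ^ m)⁻¹; 0, 1, -σ y * (ϖ ^ m)⁻¹; 0, 0, (ϖ ^ m)⁻¹])
    {α β γ δ e : K} (hh : ((h : GL (Fin 3) K) : Matrix (Fin 3) (Fin 3) K) = !![α, 0, β; 0, e, 0; γ, 0, δ]) :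
    u⁻¹ * h * u ∈ unitaryInt σ J ↔
      Valued.v γ ≤ 1 ∧ Valued.v (α + γ - e) ≤ Valued.v (ϖ ^ m) ∧ Valued.v (γ + δ - e) ≤ Valued.v (ϖ ^ m) ∧
        Valued.v (α + β + γ + δ - 2 * e) ≤ Valued.v (ϖ ^ m) * Valued.v (ϖ ^ m) := by
  have h2 : Valued.v (2 : K) = 1 := hd.v2
  have hvy : Valued.v y = 1 := by
    have hv := congrArg Valued.v hy
    rw [map_mul, hd.vσ, Valuation.map_neg, hd.v2] at hv
    exact Literature.NumberTheory.QuadraticForms.OMeara65.WithZeroMulInt.eq_one_of_mul_self hv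
  have hvσy : Valued.v (σ y) = 1 := by rw [hd.vσ, hvy]
  have hϖ0 : ϖ ≠ 0 := by
    intro h0; have := hd.vϖ; rw [h0, map_zero] at this; exact WithZero.zero_ne_coe this
  have ht0 : Valued.v (ϖ ^ m) ≠ 0 := (Valuation.ne_zero_iff _).2 (pow_ne_zero _ hϖ0)
  have htpos : 0 < Valued.v (ϖ ^ m) := zero_lt_iff.2 ht0
  have hϖ1 : Valued.v ϖ ≤ 1 := by rw [hd.vϖ, ← WithZero.exp_zero]; exact WithZero.exp_le_exp.2 (by norm_num)
  have ht1 : Valued.v (ϖ ^ m) ≤ 1 := by rw [map_pow]; exact pow_le_one' hϖ1 m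
  have hve : Valued.v e = 1 := v_eq_one_of_coe_eq_block σ hJ hd.vσ hh
  rw [mem_unitaryInt_iff_forall_v_apply_le_one σ hJ hd.vσ, coe_flickerU_inv_mul_mul_flickerU σ hd hy m hu hh]
  constructor
  · intro H
    have e01 := H 0 1; have e02 := H 0 2; have e11 := H 1 1; have e12 := H 1 2
    simp only [Matrix.of_apply, Matrix.cons_val', Matrix.cons_val_zero, Matrix.cons_val_one, Matrix.cons_val_fin_one, Matrix.cons_val,
      Matrix.empty_val', map_mul, map_inv₀, hvy, hvσy, one_mul] at e01 e02 e11 e12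
    refine ⟨?_, ?_, ?_, ?_⟩
    · -- `|2γ| ≤ max(|e|, |e − 2γ|) ≤ 1`
      have h1 : Valued.v (2 * γ) ≤ 1 := by
        have : (2 : K) * γ = e - (e - 2 * γ) := by ring
        rw [this]
        exact Valuation.map_sub_le _ hve.le e11
      rwa [map_mul, h2, one_mul] at h1
    · rwa [mul_inv_le_iff₀ htpos, one_mul] at e01
    · rwa [mul_inv_le_iff₀ htpos, one_mul] at e12
    · rw [mul_inv_le_iff₀ htpos, one_mul, mul_inv_le_iff₀ htpos] at e02
      exact e02
  · rintro ⟨hγ, h1, h3, h4⟩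
    have hαγ : Valued.v (α + γ) ≤ 1 := by
      have : α + γ = (α + γ - e) + e := by ring
      rw [this]; exact Valuation.map_add_le _ (h1.trans ht1) hve.le
    have hγδ : Valued.v (γ + δ) ≤ 1 := by
      have : γ + δ = (γ + δ - e) + e := by ring
      rw [this]; exact Valuation.map_add_le _ (h3.trans ht1) hve.le
    have he2γ : Valued.v (e - 2 * γ) ≤ 1 :=
      Valuation.map_sub_le _ hve.le (by rw [map_mul, h2, one_mul]; exact hγ)
    intro i j
    fin_cases i <;> fin_cases j <;>
      simp only [Matrix.of_apply, Matrix.cons_val', Matrix.cons_val_zero, Matrix.cons_val_one, Matrix.cons_val_fin_one, Matrix.cons_val,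
        Matrix.empty_val', Fin.mk_one, Fin.zero_eta, Fin.reduceFinMk, map_mul, map_inv₀, hvy, hvσy, one_mul]
    · exact hαγ
    · rw [mul_inv_le_iff₀ htpos, one_mul]; exact h1
    · rw [mul_inv_le_iff₀ htpos, one_mul, mul_inv_le_iff₀ htpos]; exact h4
    · exact mul_le_one' (mul_le_one' ht1 le_rfl) hγ |>.trans_eq' (by ring)
    · exact he2γ
    · rw [mul_inv_le_iff₀ htpos, one_mul]; exact h3
    · exact mul_le_one' (mul_le_one' ht1 ht1) hγ
    · exact mul_le_one' (mul_le_one' ht1 le_rfl) hγ |>.trans_eq' (by ring)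
    · exact hγδ

/-! ## (ED. 2) Coset bookkeeping: `h u_m K₀ = h′ u_m K₀ ↔ u_m⁻¹ (h⁻¹h′) u_m ∈ K₀` -/

/-- **Same double-coset representative, same `K₀`-coset ⟺ `H^K_m`** (pure group bookkeeping, Prop. 8's input): for any `h h′ u ∈ U`,
`(∃ k k′ ∈ K₀, h u k = h′ u k′) ↔ u⁻¹ (h⁻¹ h′) u ∈ K₀`; with `h, h′ ∈ H` and `u = u_m` the right side is membership of `h⁻¹h′` in
`H^K_m = H ∩ u_m K₀ u_m⁻¹`, read through `flickerU_inv_mul_mul_flickerU_mem_unitaryInt_iff`. [cite: Flicker1998UnitaryFL, Prop. 4 p. 81; Prop. 8 p. 85] -/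
theorem exists_mul_mul_eq_mul_mul_iff_mem_unitaryInt (h h' u : ↥(unitaryGroupOfForm σ J)) :
    (∃ k ∈ unitaryInt σ J, ∃ k' ∈ unitaryInt σ J, h * u * k = h' * u * k') ↔ u⁻¹ * (h⁻¹ * h') * u ∈ unitaryInt σ J := by
  constructor
  · rintro ⟨k, hk, k', hk', heq⟩
    have : u⁻¹ * (h⁻¹ * h') * u = k * k'⁻¹ := by
      have h1 : h' * u = h * u * k * k'⁻¹ := by rw [heq, mul_inv_cancel_right]
      calc u⁻¹ * (h⁻¹ * h') * u = u⁻¹ * h⁻¹ * (h' * u) := by group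
        _ = k * k'⁻¹ := by rw [h1]; group
    rw [this]
    exact Subgroup.mul_mem _ hk ((unitaryInt σ J).inv_mem hk')
  · intro hmem
    exact ⟨u⁻¹ * (h⁻¹ * h') * u, hmem, 1, (unitaryInt σ J).one_mem, by group⟩

/-- The `K₀`-coset of `h u` inside `U ∕ K₀` depends only on `h` modulo `u K₀ u⁻¹`: `h u K₀ = h′ u K₀` (as left cosets, i.e. `(h u)⁻¹ (h′ u) ∈ K₀`)
`↔ u⁻¹ (h⁻¹ h′) u ∈ K₀` — the orbit map `H ∕ H^K_m → U ∕ K₀`, `h ↦ h u_m K₀`, is well defined and injective. [cite: Flicker1998UnitaryFL, Prop. 5 p. 82] -/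
theorem inv_mul_mem_unitaryInt_iff (h h' u : ↥(unitaryGroupOfForm σ J)) :
    (h * u)⁻¹ * (h' * u) ∈ unitaryInt σ J ↔ u⁻¹ * (h⁻¹ * h') * u ∈ unitaryInt σ J := by
  rw [show (h * u)⁻¹ * (h' * u) = u⁻¹ * (h⁻¹ * h') * u by group]

end Stabilizer

end UnitaryGroup

end Literature.NumberTheory.Automorphic
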